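import Summits.NavierStokesRegularity.FluidComputer.PalasekTowerTinyBlob
import Summits.NavierStokesRegularity.FluidComputer.PalasekTowerHostFields

/-!
# The tiny blob, IV: the tiny core loop and its circulation

Cell `ns-blowup`, seat `ns-blowup-ecbridge-4` (g3); GROUP C «BRIDGE SUPPORT» of the route
`PalasekTowerBreakdown` (crux `EpisodeBaseG`, item stmt-NavierStokesRegularity-19179; negative lane
`TinyAnchoredHosts`). LABEL: E–C typing (KERNEL construction: an explicit circle and one exact
trigonometric integral). WHAT THIS IS NOT: not Navier–Stokes evidence — plane geometry of a circle,
one-variable calculus and the register's bookkeeping inequality for the core ledger.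

* §1 the `m`-fold TINY CORE LOOP `γ_{a,m}(s) = a((c + ϱ cos θ) e₁ − ϱ sin θ e₃)`, `θ = 2πms`,
  `c = 9/20`, `ϱ = 1/5`: `C¹`, closed, inside `B̄(a c e₁, aϱ)`, speed `2π m a ϱ`; along it the
  blob's radial variable is `s = ‖γ‖²/a² = α + κ cos θ` (`α = c² + ϱ²`, `κ = 2cϱ`), inside the
  FLAT ZONE `s ≤ 169/400 < 1/2` where `F = 1 − 9s² + 8s³`, `G = −6s + 6s²`;
* §2 the pairing `⟪B_a(γ), γ'⟫ = −2πm aϱ P(cos θ)` with an explicit quartic `P`, and the exact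
  circulation `∮_{γ_{a,m}} B_a = π ϱ Q · a m`, `Q = 946377/1600000` (`≈ 0.3716 · a m`), from
  `∫₀^{2πm} cos^k = 2πm, 0, πm, 0, 3πm/4` (`k = 0,…,4`);
* §3 `circulation (c • v) γ = c · circulation v γ`.

References: A. J. Majda, A. L. Bertozzi, *Vorticity and Incompressible Flow* (CUP 2002), §1.7
[cite: MajdaBertozziCUP2002, §1.7]; S. Palasek, arXiv:2605.13827 §3.1 (core loops)
[cite: Palasek2026ElementaryModel, §3.1].
-/

noncomputable section

namespace Summit.NavierStokesRegularity.FluidComputer.PalasekTowerClayBridge.TinyBlob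

open Real Set Function Filter Topology InnerProductSpace Metric MeasureTheory intervalIntegral
open scoped Topology ContDiff RealInnerProductSpace

open Literature.Analysis.FluidPDE

variable {a : ℝ}

/-! ## §1 The tiny core loop -/

/-- `e₁ = (1, 0, 0)`. [folklore] -/
def e₁ : EuclideanSpace ℝ (Fin 3) := EuclideanSpace.single 0 1

/-- The centre ratio `c = 9/20` of the loop. [folklore] -/
def lc : ℝ := 9 / 20

/-- The radius ratio `ϱ = 1/5` of the loop. [folklore] -/
def lr : ℝ := 1 / 5

/-- `α = c² + ϱ² = 97/400`. [folklore] -/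
def lα : ℝ := 97 / 400

/-- `κ = 2cϱ = 9/50`. [folklore] -/
def lκ : ℝ := 9 / 50

/-- **The `m`-fold tiny core loop** `s ↦ a((c + ϱ cos 2πms) e₁ − ϱ sin 2πms · e₃)`. [folklore] -/
def tinyLoop (a : ℝ) (m : ℕ) (s : ℝ) : EuclideanSpace ℝ (Fin 3) :=
  (a * (lc + lr * Real.cos (2 * π * m * s))) • e₁ + (-(a * lr * Real.sin (2 * π * m * s))) • e₃

/-- Its velocity (chain-rule form). [folklore] -/
def tinyLoopVel (a : ℝ) (m : ℕ) (s : ℝ) : EuclideanSpace ℝ (Fin 3) :=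
  (a * (lr * (-Real.sin (2 * π * m * s) * (2 * π * m)))) • e₁ +
    (-(a * lr * (Real.cos (2 * π * m * s) * (2 * π * m)))) • e₃

/-- The loop is differentiable with derivative `tinyLoopVel`. [folklore] -/
theorem hasDerivAt_tinyLoop (a : ℝ) (m : ℕ) (s : ℝ) :
    HasDerivAt (tinyLoop a m) (tinyLoopVel a m s) s := by
  have hω : HasDerivAt (fun s : ℝ => 2 * π * m * s) (2 * π * m) s := by
    simpa using (hasDerivAt_id s).const_mul (2 * π * m)
  exact ((((hω.cos.const_mul lr).const_add lc).const_mul a).smul_const e₁).add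
    (((hω.sin.const_mul (a * lr)).neg).smul_const e₃)

/-- `deriv γ = tinyLoopVel`. [folklore] -/
theorem deriv_tinyLoop (a : ℝ) (m : ℕ) (s : ℝ) : deriv (tinyLoop a m) s = tinyLoopVel a m s :=
  (hasDerivAt_tinyLoop a m s).deriv

/-- The loop is `C¹`. [folklore] -/
theorem contDiff_tinyLoop (a : ℝ) (m : ℕ) : ContDiff ℝ 1 (tinyLoop a m) :=
  ((contDiff_const.mul (contDiff_const.add (contDiff_const.mul
    (contDiff_const.mul contDiff_id).cos))).smul contDiff_const).add
    ((contDiff_const.mul (contDiff_const.mul contDiff_id).sin).neg.smul contDiff_const)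

/-- `sin 2πm = 0`. [folklore] -/
theorem sin_two_pi_mul_nat (m : ℕ) : Real.sin (2 * π * m) = 0 := by
  rw [show 2 * π * (m : ℝ) = ((2 * m : ℕ) : ℝ) * π by push_cast; ring]
  exact Real.sin_nat_mul_pi _

/-- `cos 2πm = 1`. [folklore] -/
theorem cos_two_pi_mul_nat (m : ℕ) : Real.cos (2 * π * m) = 1 := by
  rw [show 2 * π * (m : ℝ) = (m : ℝ) * (2 * π) by ring]
  exact Real.cos_nat_mul_two_pi _

/-- The loop is closed. [folklore] -/
theorem tinyLoop_zero_eq_one (a : ℝ) (m : ℕ) : tinyLoop a m 0 = tinyLoop a m 1 := by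
  simp only [tinyLoop, mul_zero, mul_one, Real.cos_zero, Real.sin_zero, sin_two_pi_mul_nat,
    cos_two_pi_mul_nat]

/-- Components of the loop. [folklore] -/
theorem tinyLoop_apply (a : ℝ) (m : ℕ) (s : ℝ) :
    tinyLoop a m s 0 = a * (lc + lr * Real.cos (2 * π * m * s)) ∧ tinyLoop a m s 1 = 0 ∧
      tinyLoop a m s 2 = -(a * lr * Real.sin (2 * π * m * s)) := by
  refine ⟨?_, ?_, ?_⟩ <;> simp [tinyLoop, e₁, e₃]

/-- Components of the loop velocity. [folklore] -/
theorem tinyLoopVel_apply (a : ℝ) (m : ℕ) (s : ℝ) :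
    tinyLoopVel a m s 0 = a * (lr * (-Real.sin (2 * π * m * s) * (2 * π * m))) ∧
      tinyLoopVel a m s 1 = 0 ∧
      tinyLoopVel a m s 2 = -(a * lr * (Real.cos (2 * π * m * s) * (2 * π * m))) := by
  refine ⟨?_, ?_, ?_⟩ <;> simp [tinyLoopVel, e₁, e₃]

/-- The loop relative to its centre `a c e₁`. [folklore] -/
theorem tinyLoop_sub_center (a : ℝ) (m : ℕ) (s : ℝ) :
    tinyLoop a m s - (a * lc) • e₁ =
      (a * lr * Real.cos (2 * π * m * s)) • e₁ + (-(a * lr * Real.sin (2 * π * m * s))) • e₃ := by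
  rw [tinyLoop, sub_eq_iff_eq_add, mul_add, add_smul, ← mul_assoc]
  abel

/-- Components of the loop relative to its centre. [folklore] -/
theorem tinyLoop_sub_center_apply (a : ℝ) (m : ℕ) (s : ℝ) :
    (tinyLoop a m s - (a * lc) • e₁) 0 = a * lr * Real.cos (2 * π * m * s) ∧
      (tinyLoop a m s - (a * lc) • e₁) 1 = 0 ∧
      (tinyLoop a m s - (a * lc) • e₁) 2 = -(a * lr * Real.sin (2 * π * m * s)) := by
  rw [tinyLoop_sub_center]
  refine ⟨?_, ?_, ?_⟩ <;> simp [e₁, e₃]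

/-- The loop lies on the circle of radius `aϱ` about `a c e₁`. [folklore] -/
theorem norm_tinyLoop_sub_center (ha : 0 ≤ a) (m : ℕ) (s : ℝ) :
    ‖tinyLoop a m s - (a * lc) • e₁‖ = a * lr := by
  obtain ⟨h0, h1, h2⟩ := tinyLoop_sub_center_apply a m s
  rw [EuclideanSpace.norm_eq, Fin.sum_univ_three, h0, h1, h2]
  have e : ‖a * lr * Real.cos (2 * π * m * s)‖ ^ 2 + ‖(0 : ℝ)‖ ^ 2 +
      ‖-(a * lr * Real.sin (2 * π * m * s))‖ ^ 2 = (a * lr) ^ 2 := by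
    simp only [Real.norm_eq_abs, sq_abs, norm_zero]
    linear_combination (a * lr) ^ 2 * Real.sin_sq_add_cos_sq (2 * π * m * s)
  rw [e, Real.sqrt_sq (by rw [lr]; positivity)]

/-- The speed of the loop is `2πm aϱ`. [folklore] -/
theorem norm_tinyLoopVel (ha : 0 ≤ a) (m : ℕ) (s : ℝ) :
    ‖tinyLoopVel a m s‖ = 2 * π * m * (a * lr) := by
  obtain ⟨h0, h1, h2⟩ := tinyLoopVel_apply a m s
  rw [EuclideanSpace.norm_eq, Fin.sum_univ_three, h0, h1, h2]
  have e : ‖a * (lr * (-Real.sin (2 * π * m * s) * (2 * π * m)))‖ ^ 2 + ‖(0 : ℝ)‖ ^ 2 +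
      ‖-(a * lr * (Real.cos (2 * π * m * s) * (2 * π * m)))‖ ^ 2 = (2 * π * m * (a * lr)) ^ 2 := by
    simp only [Real.norm_eq_abs, sq_abs, norm_zero]
    linear_combination (2 * π * m * (a * lr)) ^ 2 * Real.sin_sq_add_cos_sq (2 * π * m * s)
  rw [e, Real.sqrt_sq (by rw [lr]; positivity)]

/-- The centre has norm `a c`. [folklore] -/
theorem norm_center (ha : 0 ≤ a) : ‖(a * lc) • e₁‖ = a * lc := by
  rw [norm_smul, show ‖e₁‖ = 1 by simp [e₁], mul_one, Real.norm_eq_abs,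
    abs_of_nonneg (by rw [lc]; positivity)]

/-- **The radial variable along the loop**: `‖γ‖²/a² = α + κ cos θ`. [folklore] -/
theorem sqn_tinyLoop (ha : a ≠ 0) (m : ℕ) (s : ℝ) :
    sqn a (tinyLoop a m s) = lα + lκ * Real.cos (2 * π * m * s) := by
  obtain ⟨h0, h1, h2⟩ := tinyLoop_apply a m s
  have hn : ‖tinyLoop a m s‖ ^ 2 = a ^ 2 * (lα + lκ * Real.cos (2 * π * m * s)) := by
    rw [EuclideanSpace.norm_sq_eq, Fin.sum_univ_three, h0, h1, h2]
    simp only [Real.norm_eq_abs, sq_abs, lc, lr, lα, lκ]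
    linear_combination (a / 5) ^ 2 * Real.sin_sq_add_cos_sq (2 * π * m * s)
  rw [sqn, hn]
  field_simp

/-- The loop stays in the flat zone: `α + κ cos θ ≤ 1/2`. [folklore] -/
theorem lα_add_le (θ : ℝ) : lα + lκ * Real.cos θ ≤ 1 / 2 := by
  have := Real.cos_le_one θ
  rw [lα, lκ]; nlinarith

/-! ## §2 The pairing and the circulation -/

/-- The quartic `P(C) = F(α + κC) C + cϱ G(α + κC)(1 − C²)`, expanded. [folklore] -/
def pquart (C : ℝ) : ℝ :=
  -793557 / 8000000 + 4278159 / 8000000 * C - 3319731 / 8000000 * C ^ 2 - 26487 / 500000 * C ^ 3 +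
    729 / 25000 * C ^ 4

/-- `P` is the announced combination of the flat-zone profiles. [folklore] -/
theorem pquart_eq (C : ℝ) :
    pquart C = (1 - 9 * (lα + lκ * C) ^ 2 + 8 * (lα + lκ * C) ^ 3) * C +
      lc * lr * (-6 * (lα + lκ * C) + 6 * (lα + lκ * C) ^ 2) * (1 - C ^ 2) := by
  rw [pquart, lα, lκ, lc, lr]; ring

/-- `⟪γ, γ'⟫ = −2πm a² cϱ sin θ`. [folklore] -/
theorem inner_tinyLoop_vel (a : ℝ) (m : ℕ) (s : ℝ) :
    ⟪tinyLoop a m s, tinyLoopVel a m s⟫ =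
      -(2 * π * m * (a ^ 2 * (lc * lr)) * Real.sin (2 * π * m * s)) := by
  obtain ⟨h0, h1, h2⟩ := tinyLoop_apply a m s
  obtain ⟨k0, k1, k2⟩ := tinyLoopVel_apply a m s
  have h : ⟪tinyLoop a m s, tinyLoopVel a m s⟫ =
      tinyLoop a m s 0 * tinyLoopVel a m s 0 + tinyLoop a m s 1 * tinyLoopVel a m s 1 +
        tinyLoop a m s 2 * tinyLoopVel a m s 2 := by
    rw [real_inner_comm, EuclideanSpace.inner_eq_star_dotProduct]
    simp [dotProduct, Fin.sum_univ_three]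
  rw [h, h0, h1, h2, k0, k1, k2]
  ring

/-- `⟪e₃, γ'⟫ = −2πm aϱ cos θ`. [folklore] -/
theorem inner_e₃_vel (a : ℝ) (m : ℕ) (s : ℝ) :
    ⟪e₃, tinyLoopVel a m s⟫ = -(2 * π * m * (a * lr) * Real.cos (2 * π * m * s)) := by
  rw [inner_e₃_left, (tinyLoopVel_apply a m s).2.2]; ring

/-- **THE PAIRING**: `⟪B_a(γ(s)), γ'(s)⟫ = −2πm aϱ P(cos 2πms)`. [folklore] -/
theorem inner_tinyBlob_vel (ha : a ≠ 0) (m : ℕ) (s : ℝ) :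
    ⟪tinyBlob a (tinyLoop a m s), tinyLoopVel a m s⟫ =
      -(2 * π * m * (a * lr) * pquart (Real.cos (2 * π * m * s))) := by
  have hS := sqn_tinyLoop ha m s
  have hflat := lα_add_le (2 * π * m * s)
  rw [tinyBlob_eq, inner_sub_left, real_inner_smul_left, real_inner_smul_left, inner_e₃_vel,
    inner_tinyLoop_vel, (tinyLoop_apply a m s).2.2, hS, blobF_of_le_half hflat,
    blobG_of_le_half hflat, pquart_eq]
  have hdiv : ∀ X Y : ℝ, X / a ^ 2 * -(2 * π * m * (a ^ 2 * (lc * lr)) * Y) =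
      -(X * (2 * π * m * (lc * lr) * Y)) := by
    intro X Y; field_simp
  rw [hdiv]
  linear_combination (-(2 * π * m * a * lc * lr ^ 2) *
    (-6 * (lα + lκ * Real.cos (2 * π * m * s)) + 6 * (lα + lκ * Real.cos (2 * π * m * s)) ^ 2)) *
      Real.sin_sq_add_cos_sq (2 * π * m * s)

/-- `∫₀^b (p₀ + p₁ cos + p₂ cos² + p₃ cos³ + p₄ cos⁴) = b (p₀ + p₂/2 + 3p₄/8)` when `sin b = 0`,
`cos b = 1`. [folklore] -/
theorem integral_quartic_cos {b : ℝ} (hs : Real.sin b = 0) (p₀ p₁ p₂ p₃ p₄ : ℝ) :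
    ∫ θ in (0 : ℝ)..b, (p₀ + p₁ * Real.cos θ + p₂ * Real.cos θ ^ 2 + p₃ * Real.cos θ ^ 3 +
      p₄ * Real.cos θ ^ 4) = b * (p₀ + p₂ / 2 + 3 * p₄ / 8) := by
  have hi : ∀ (k : ℕ) (c : ℝ), IntervalIntegrable (fun θ => c * Real.cos θ ^ k) volume 0 b :=
    fun k c => (continuous_const.mul (Real.continuous_cos.pow k)).intervalIntegrable _ _
  have h0 : IntervalIntegrable (fun _ : ℝ => p₀) volume 0 b := intervalIntegrable_const
  have h1 : IntervalIntegrable (fun θ => p₁ * Real.cos θ) volume 0 b := by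
    have h := hi 1 p₁
    simp only [pow_one] at h
    exact h
  rw [integral_add (((h0.add h1).add (hi 2 p₂)).add (hi 3 p₃)) (hi 4 p₄),
    integral_add ((h0.add h1).add (hi 2 p₂)) (hi 3 p₃), integral_add (h0.add h1) (hi 2 p₂),
    integral_add h0 h1, intervalIntegral.integral_const, intervalIntegral.integral_const_mul,
    intervalIntegral.integral_const_mul, intervalIntegral.integral_const_mul,
    intervalIntegral.integral_const_mul, integral_cos, integral_cos_sq, integral_cos_pow_three,
    integral_cos_pow, integral_cos_sq]
  simp only [hs, Real.sin_zero, Real.cos_zero, sub_zero, mul_zero, smul_eq_mul]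
  norm_num
  ring

/-- **THE CIRCULATION OF THE BLOB AROUND THE TINY LOOP**: `∮ B_a = π ϱ Q · a m`,
`Q = 946377/1600000`. [folklore] -/
theorem circulation_tinyBlob_tinyLoop (ha : a ≠ 0) {m : ℕ} (hm : 0 < m) :
    circulation (tinyBlob a) (tinyLoop a m) = π * lr * (946377 / 1600000) * (a * m) := by
  have hω : (2 * π * (m : ℝ)) ≠ 0 := by
    have : (0 : ℝ) < m := by exact_mod_cast hm
    positivity
  simp only [circulation, deriv_tinyLoop, inner_tinyBlob_vel ha]
  rw [intervalIntegral.integral_neg, intervalIntegral.integral_const_mul,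
    intervalIntegral.integral_comp_mul_left (fun θ => pquart (Real.cos θ)) hω]
  simp only [mul_zero, mul_one, smul_eq_mul, pquart]
  have hI := integral_quartic_cos (b := 2 * π * m) (sin_two_pi_mul_nat m)
    (-793557 / 8000000) (4278159 / 8000000) (-(3319731 / 8000000)) (-(26487 / 500000))
    (729 / 25000)
  have hI' : ∫ θ in (0 : ℝ)..2 * π * m, (-793557 / 8000000 + 4278159 / 8000000 * Real.cos θ -
      3319731 / 8000000 * Real.cos θ ^ 2 - 26487 / 500000 * Real.cos θ ^ 3 +
        729 / 25000 * Real.cos θ ^ 4) = 2 * π * m * (-793557 / 8000000 + -(3319731 / 8000000) / 2 +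
          3 * (729 / 25000) / 8) := by
    rw [← hI]
    congr 1; funext θ; ring
  rw [hI']
  field_simp
  ring

/-! ## §3 Scaling the field scales the circulation -/

/-- `∮ (c • v) = c ∮ v`. [folklore] -/
theorem circulation_const_smul (c : ℝ) (v : EuclideanSpace ℝ (Fin 3) → EuclideanSpace ℝ (Fin 3))
    (γ : ℝ → EuclideanSpace ℝ (Fin 3)) :
    circulation (fun y => c • v y) γ = c * circulation v γ := by
  simp only [circulation, real_inner_smul_left, intervalIntegral.integral_const_mul]

/-- Lower bound: `∮_{γ_{a,m}} B_a ≥ (7/20) · a m` (`π ϱ Q ≈ 0.3716`). [folklore] -/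
theorem circulation_tinyBlob_tinyLoop_ge (ha : 0 < a) {m : ℕ} (hm : 0 < m) :
    7 / 20 * (a * m) ≤ circulation (tinyBlob a) (tinyLoop a m) := by
  rw [circulation_tinyBlob_tinyLoop ha.ne' hm, lr]
  have hπ := Real.pi_gt_three
  have ham : 0 < a * m := mul_pos ha (by exact_mod_cast hm)
  nlinarith

end Summit.NavierStokesRegularity.FluidComputer.PalasekTowerClayBridge.TinyBlob

end
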